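import Summits.BirchSwinnertonDyer.Rank1Residual.Supersingular.MazurTateValuation
import HarnessLib

/-!
# `a_p = 0` (classes X6 / X7): valuations of the cyclotomic twists for Pollack's `L_p^±` in
# Kobayashi's labelling, and the ONE-VALUE CERTIFICATE for `(μ, λ)(L_p^ε)`
# (cell `b2b-bsdres`, supersingular family, prover B = unit `b2b-bsdres-additive-p3`, gen 10; part 5/5;
# for prover A = `b2b-bsdres-x10b` and the X6/X7 rank-one squeezes)

HONEST FRAMING (run/shared/lean/b2b/bsd-rank1-residual/, verbatim in every file): the goal of the
cell is to DELETE the COMBINATION-SHAPED residual classes of the Birch–Swinnerton-Dyer formula for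
ALL analytic-rank `≤ 1` elliptic curves over `ℚ` — "full BSD formula for every rank `≤ 1` curve in
class `C`" assembled STRICTLY from published theorems — so that the rank-`≤ 1` remainder becomes
exactly the CONSTRUCTION-SHAPED classes, which are TYPED (missing-input `Prop`s), NOT attempted.
This is not "finishing BSD". THEOREMS ONLY (no definition, no named fact, no `sorry`); nothing about
any particular curve is asserted; nothing is booked; X6 / X7 / X8 stay CONSTRUCTION-SHAPED.

## What this file proves (part 4 = `Supersingular/MazurTateValuation.lean` for THE Sprung pair)

For `p ≠ 2` good with `a_p = 0`, `f` the newform of `E = W`, and Kobayashi's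
`IsSignedPAdicLFunction f p ε L` (harvest-2 p209183; `ε = −1 ↔` odd levels `↔` the tree's
`L⁺ = L♯`, `ε = 1 ↔` even levels `↔ L⁻ = L♭`; unique, `IsSignedPAdicLFunction.unique`; Pollack's
theorem `pollack_exists_plusMinusPAdicLFunction_holds` + `isSprungPair_zero_iff` identify it with a
component of THE Sprung pair):
* `signed_neg_one_norm_ratTwistedSymbolSum_pow_totient_eq` / `signed_one_…`: `L ≠ 0`, `μ(L) = 0`,
  `λ(L) + deg ω_n^± < φ(pⁿ)` (`n = k+1` of parity `ε`) ⇒ EVERY primitive even `p`-power-order `χ` mod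
  `p^{n+e₀}` has `|∑_a χ(a)[a/p^{n+e₀}]⁺_f|^{φ(pⁿ)} = p^{−(deg ω_n^± + λ(L))}` — Pollack's
  "`ord_p` of the twisted values `= (q_n + λ^±)/φ(pⁿ)`" as a kernel theorem on the tree objects;
* `signed_neg_one_mu_eq_zero_and_lam_add_eq_of_lt_norm` / `signed_one_…`: ONE such `χ` with
  `|Birch(χ)| > 1/p` certifies `μ(L) = 0` and `λ(L) + deg ω_n^± = φ(pⁿ)·v_p(Birch(χ)) < φ(pⁿ)` — the
  `hcert`/`hμ`/`hlam` binders of `kobayashiMainConjecture_of_lam_eq_one_of_analyticRank_eq_one`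
  (X7/X6 rank-one squeezes, 31 pairs) read from one twisted value instead of a coefficient scan.
Analytic side only; nothing about Selmer groups or BSD_p of any pair.

References: [Pollack2003] Prop. 6.9–6.10, 6.18; [Kobayashi2003] (3.4)–(3.6) (p. 7);
[Washington1997] §7.1–7.2. Memo: HOME/b2b-bsdres-additive-p3/X8-ROUTE-B.md §15 (gen 10).
-/

set_option autoImplicit false

noncomputable section

open scoped Classical MatrixGroups ModularForm

open CongruenceSubgroup Polynomial WeierstrassCurve Literature.NumberTheory.EllipticCurves
  Literature.NumberTheory.EllipticCurves.ModularForms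
  Literature.NumberTheory.EllipticCurves.Sprung2017
  Literature.NumberTheory.EllipticCurves.Rank1Residual
  Summit.BirchSwinnertonDyer.Rank1Residual.X1.MuLambda
  Summit.BirchSwinnertonDyer.Rank1Residual.Iwasawa

namespace Summit.BirchSwinnertonDyer.Rank1Residual.Supersingular

/-! ## §11. `a_p = 0`: the same for Pollack's `L_p^∓` in Kobayashi's labelling (X6 / X7) -/

section Signed

variable {W : WeierstrassCurve ℚ} [W.IsElliptic] [W.IsGloballyMinimal] {N : ℕ} [NeZero N]
  {f : CuspForm (Gamma0 N) 2} {p : ℕ} [hp : Fact p.Prime]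

open Literature.NumberTheory.EllipticCurves.Kobayashi2003 in
/-- **`a_p = 0`, sign `ε = −1` (Kobayashi's `L_p^-` = the tree's `L⁺ = L♯`, ODD levels): valuation
of the twists.** For `p ≠ 2` good with `a_p = 0`, `f` the newform of `E`, ANY `L` with
`IsSignedPAdicLFunction f p (-1) L` (unique), `L ≠ 0`, `μ(L) = 0`, `n = k + 1` odd,
`λ(L) + deg ω_n^+ < φ(pⁿ)`: every primitive even `p`-power-order `χ` mod `p^{n+e₀}` has
`|∑_a χ(a)[a/p^{n+e₀}]⁺_f|^{φ(pⁿ)} = p^{−(deg ω_n^+ + λ(L))}`. [cite: Pollack2003, Prop. 6.9, Prop. 6.10 and Prop. 6.18]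
[cite: Kobayashi2003, (3.4)–(3.5) (p. 7)] -/
theorem signed_neg_one_norm_ratTwistedSymbolSum_pow_totient_eq (hp2 : p ≠ 2) (hf : IsNewformOf W f)
    (hgood : W.HasGoodReductionAtPrime p) (hap : W.frobeniusTrace p = 0)
    {L : IwasawaAlgebra p} (hL : IsSignedPAdicLFunction f p (-1) L) (hL0 : L ≠ 0) (hμL : mu L = 0)
    {k : ℕ} (hn : Odd (k + 1))
    (hlt : lam L + (cyclotomicOmegaPlus p (k + 1)).natDegree < Nat.totient (p ^ (k + 1)))
    (χ : DirichletCharacter ℂ_[p] (p ^ (k + 1 + cyclotomicExponent p))) (hχ : χ.IsPrimitive)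
    (hev : χ.Even) (hord : ∃ j : ℕ, orderOf χ = p ^ j) :
    ‖ratTwistedSymbolSum f χ‖ ^ Nat.totient (p ^ (k + 1)) =
      ((p : ℝ)⁻¹) ^ ((cyclotomicOmegaPlus p (k + 1)).natDegree + lam L) := by
  obtain ⟨Lplus, Lminus, -, -, hodd, heven⟩ :=
    pollack_exists_plusMinusPAdicLFunction_holds (W := W) (f := f) (p := p) hp2 hf hgood hap
  have hSP : IsSprungPair f p (W.frobeniusTrace p) Lplus Lminus := by
    rw [hap]
    exact (isSprungPair_zero_iff f p Lplus Lminus).mpr ⟨hodd, heven⟩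
  have hLeq : L = Lplus := hL.unique ((isSignedPAdicLFunction_neg_one_iff f p Lplus).mpr hodd)
  subst hLeq
  have hap' : (p : ℤ) ∣ W.frobeniusTrace p := by rw [hap]; exact dvd_zero _
  exact norm_ratTwistedSymbolSum_pow_totient_eq_of_lam_sharp hp2 hf hgood hap' hSP hL0 hμL hn hlt χ
    hχ hev hord

open Literature.NumberTheory.EllipticCurves.Kobayashi2003 in
/-- **`a_p = 0`, sign `ε = 1` (Kobayashi's `L_p^+` = the tree's `L⁻ = L♭`, EVEN levels)**: the same
with `deg ω_n^-`. [cite: Pollack2003, Prop. 6.9, Prop. 6.10 and Prop. 6.18] [cite: Kobayashi2003, (3.4)–(3.5) (p. 7)] -/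
theorem signed_one_norm_ratTwistedSymbolSum_pow_totient_eq (hp2 : p ≠ 2) (hf : IsNewformOf W f)
    (hgood : W.HasGoodReductionAtPrime p) (hap : W.frobeniusTrace p = 0)
    {L : IwasawaAlgebra p} (hL : IsSignedPAdicLFunction f p 1 L) (hL0 : L ≠ 0) (hμL : mu L = 0)
    {k : ℕ} (hn : Even (k + 1))
    (hlt : lam L + (cyclotomicOmegaMinus p (k + 1)).natDegree < Nat.totient (p ^ (k + 1)))
    (χ : DirichletCharacter ℂ_[p] (p ^ (k + 1 + cyclotomicExponent p))) (hχ : χ.IsPrimitive)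
    (hev : χ.Even) (hord : ∃ j : ℕ, orderOf χ = p ^ j) :
    ‖ratTwistedSymbolSum f χ‖ ^ Nat.totient (p ^ (k + 1)) =
      ((p : ℝ)⁻¹) ^ ((cyclotomicOmegaMinus p (k + 1)).natDegree + lam L) := by
  obtain ⟨Lplus, Lminus, -, -, hodd, heven⟩ :=
    pollack_exists_plusMinusPAdicLFunction_holds (W := W) (f := f) (p := p) hp2 hf hgood hap
  have hSP : IsSprungPair f p (W.frobeniusTrace p) Lplus Lminus := by
    rw [hap]
    exact (isSprungPair_zero_iff f p Lplus Lminus).mpr ⟨hodd, heven⟩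
  have hLeq : L = Lminus := hL.unique ((isSignedPAdicLFunction_one_iff f p Lminus).mpr heven)
  subst hLeq
  have hap' : (p : ℤ) ∣ W.frobeniusTrace p := by rw [hap]; exact dvd_zero _
  exact norm_ratTwistedSymbolSum_pow_totient_eq_of_lam_flat hp2 hf hgood hap' hSP hL0 hμL hn hlt χ
    hχ hev hord

open Literature.NumberTheory.EllipticCurves.Kobayashi2003 in
/-- **`a_p = 0`: ONE-VALUE CERTIFICATE for `(μ, λ)(L_p^ε)`**, `ε = −1` (odd levels): ONE `χ` mod
`p^{n+e₀}`, `n = k+1` odd, with `|Birch(χ)| > 1/p` ⇒ `μ(L) = 0`, `λ(L) + deg ω_n^+ < φ(pⁿ)`,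
`|Birch(χ)|^{φ(pⁿ)} = p^{−(λ(L) + deg ω_n^+)}`. [cite: Pollack2003, Prop. 6.9, Prop. 6.10 and Prop. 6.18]
[cite: Kobayashi2003, (3.4)–(3.5) (p. 7)] -/
theorem signed_neg_one_mu_eq_zero_and_lam_add_eq_of_lt_norm (hp2 : p ≠ 2) (hf : IsNewformOf W f)
    (hgood : W.HasGoodReductionAtPrime p) (hap : W.frobeniusTrace p = 0)
    {L : IwasawaAlgebra p} (hL : IsSignedPAdicLFunction f p (-1) L) {k : ℕ} (hn : Odd (k + 1))
    (χ : DirichletCharacter ℂ_[p] (p ^ (k + 1 + cyclotomicExponent p))) (hχ : χ.IsPrimitive)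
    (hev : χ.Even) (hord : ∃ j : ℕ, orderOf χ = p ^ j) (h : (p : ℝ)⁻¹ < ‖ratTwistedSymbolSum f χ‖) :
    mu L = 0 ∧ lam L + (cyclotomicOmegaPlus p (k + 1)).natDegree < Nat.totient (p ^ (k + 1)) ∧
      ‖ratTwistedSymbolSum f χ‖ ^ Nat.totient (p ^ (k + 1)) =
        ((p : ℝ)⁻¹) ^ (lam L + (cyclotomicOmegaPlus p (k + 1)).natDegree) := by
  obtain ⟨Lplus, Lminus, -, -, hodd, heven⟩ :=
    pollack_exists_plusMinusPAdicLFunction_holds (W := W) (f := f) (p := p) hp2 hf hgood hap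
  have hSP : IsSprungPair f p (W.frobeniusTrace p) Lplus Lminus := by
    rw [hap]
    exact (isSprungPair_zero_iff f p Lplus Lminus).mpr ⟨hodd, heven⟩
  have hLeq : L = Lplus := hL.unique ((isSignedPAdicLFunction_neg_one_iff f p Lplus).mpr hodd)
  subst hLeq
  have hap' : (p : ℤ) ∣ W.frobeniusTrace p := by rw [hap]; exact dvd_zero _
  exact mu_sharp_eq_zero_and_lam_sharp_add_eq_of_lt_norm hp2 hf hgood hap' hSP hn χ hχ hev hord h

open Literature.NumberTheory.EllipticCurves.Kobayashi2003 in
/-- **`a_p = 0`: ONE-VALUE CERTIFICATE**, `ε = 1` (even levels, `deg ω_n^-`).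
[cite: Pollack2003, Prop. 6.9, Prop. 6.10 and Prop. 6.18] [cite: Kobayashi2003, (3.4)–(3.5) (p. 7)] -/
theorem signed_one_mu_eq_zero_and_lam_add_eq_of_lt_norm (hp2 : p ≠ 2) (hf : IsNewformOf W f)
    (hgood : W.HasGoodReductionAtPrime p) (hap : W.frobeniusTrace p = 0)
    {L : IwasawaAlgebra p} (hL : IsSignedPAdicLFunction f p 1 L) {k : ℕ} (hn : Even (k + 1))
    (χ : DirichletCharacter ℂ_[p] (p ^ (k + 1 + cyclotomicExponent p))) (hχ : χ.IsPrimitive)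
    (hev : χ.Even) (hord : ∃ j : ℕ, orderOf χ = p ^ j) (h : (p : ℝ)⁻¹ < ‖ratTwistedSymbolSum f χ‖) :
    mu L = 0 ∧ lam L + (cyclotomicOmegaMinus p (k + 1)).natDegree < Nat.totient (p ^ (k + 1)) ∧
      ‖ratTwistedSymbolSum f χ‖ ^ Nat.totient (p ^ (k + 1)) =
        ((p : ℝ)⁻¹) ^ (lam L + (cyclotomicOmegaMinus p (k + 1)).natDegree) := by
  obtain ⟨Lplus, Lminus, -, -, hodd, heven⟩ :=
    pollack_exists_plusMinusPAdicLFunction_holds (W := W) (f := f) (p := p) hp2 hf hgood hap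
  have hSP : IsSprungPair f p (W.frobeniusTrace p) Lplus Lminus := by
    rw [hap]
    exact (isSprungPair_zero_iff f p Lplus Lminus).mpr ⟨hodd, heven⟩
  have hLeq : L = Lminus := hL.unique ((isSignedPAdicLFunction_one_iff f p Lminus).mpr heven)
  subst hLeq
  have hap' : (p : ℤ) ∣ W.frobeniusTrace p := by rw [hap]; exact dvd_zero _
  exact mu_flat_eq_zero_and_lam_flat_add_eq_of_lt_norm hp2 hf hgood hap' hSP hn χ hχ hev hord h

end Signed

end Summit.BirchSwinnertonDyer.Rank1Residual.Supersingular

end
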